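import Literature.MathematicalPhysics.QuantumFieldTheory.Balaban1983to89.B9Thm31SiteGpBoundsReg335Y
import Literature.MathematicalPhysics.QuantumFieldTheory.Balaban1983to89.B9Thm311CoercivePureGaugeAtLettersY
import Literature.MathematicalPhysics.QuantumFieldTheory.Balaban1983to89.B9Thm311CubeLettersG

/-!
# `Balaban1983to89.B9Thm311CubeLettersGCoercive` — [B9] (3.84)–(3.86) p. 407 and Theorem 3.11 p. 416 FOR THE CUBE LETTERS `Δ_{a,□}(U)`, `G_□(U)` IN `L²`:
# «V(A)G(U) is a small operator» FROM A FIRST-ORDER RELATIVE BOUND — a carrier-generic Kato-type engine in print's trace currency, read at r05's cube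
# letters: coercivity ∕ positivity ∕ invertibility of `Δ_{a,□}(U′)` and the `L²` size of `G_□(U′)` from TWO displayed inputs, and r05's displayed `hV`
# (`B9Thm311CubeLettersG`) DERIVED from the same two inputs

statement-level skeleton of published theorems with citation tags; proofs where landed; nothing here is a claim about the Yang–Mills mass gap

T. Bałaban, *Propagators for lattice gauge theories in a background field*, Commun. Math. Phys. **99** (1985) 389–434 [`Balaban1985BackgroundPropagators`,
"[B9]"; held text `paper:balaban1985-cmp99-background-propagators`, journal page = PDF page + 388; pp. 407–408, 416 read first-hand by this seat];
T. Bałaban, *Propagators and renormalization transformations for lattice gauge theories. II*, Commun. Math. Phys. **96** (1984) 223–250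
[`Balaban1984PropagatorsII`, "[4]"], (2.22) p. 226, p. 228 («The operator G is positive»).

THE PRINT (verbatim).  p. 407: «The operator V₃(A) is a local differential operator of the first order satisfying the bound (3.73). The operator P₁(A)
… is a non-local bounded operator and satisfies the bound (3.77). The operator P₂(A) … satisfies the bound (3.83) … Let us denote the sum of these
three operators by V(A). We can write (3.82) as Δ_a(U′U) = Δ_a(U) − V(A) = (I − V(A)G(U))Δ_a(U). (3.84) Using the bounds (3.73), (3.77), (3.83) and
assuming that Theorem 3.3 holds for G(U), we get |(V(A)G(U)J)(b)| ≦ O(1)α₁e^{−(1/2)δ₀d(y,y′)}|J| … (3.85) … hence V(A)G(U) is a small operator in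
supremum norm, and we have G(U′U) = G(U)(I − V(A)G(U))⁻¹ = Σ_{n=0}^∞ G(U)(V(A)G(U))ⁿ, (3.86) and convergence is in the operator norm for α₁ sufficiently
small.»  p. 416 (Thm 3.11): «Doing the gauge transformation we get the configuration U = e^{iηA} with A small, and by (3.86) we get G_□(e^{iηA}) =
G_□(1)(I − V(A)G_□(1))⁻¹. In [4] we have proved that the operator G_□(1) is positive, hence by the same reasoning as above we prove positivity of G_□.»

WHY THIS FILE.  r05 g81's `B9Thm311CubeLettersG` (cell `lit-balaban`, sub-row G-B9-LETTERS, module M5.1c) typed the p. 416 road for the cube letter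
`G_□(U) = GACubeY` and left ONE analytic input displayed — `hV`: the form-smallness `⟨B, V(A)G_□(1)B⟩ < ⟨B, B⟩` at the (3.35) gauge.  Print gets that
smallness from the STRUCTURE of `V(A)` (first order + bounded, each `O(α₁)` at the natural scales) against the mapping properties of `G(U)`.  THIS FILE
types that mechanism in `L²`: with (i) a flat coercivity `m⟨C, C⟩ ≦ ⟨C, Δ_{a,□}(1)C⟩` ([4] (2.22), p. 228; the tree has the qualitative
`deltaACubeY_parSymY_one_posDefTr`, whence SOME `m > 0`, §3; print's `m = O(1)(Lʲη)⁻²` is not located here) and (ii) the FIRST-ORDER RELATIVE BOUND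
`|⟨B, V(A)C⟩| ≦ ‖B‖·(a‖C‖ + b·⟨C, Δ_{a,□}(1)C⟩^{1/2})` (print's (3.73)∕(3.77)∕(3.83) read in `L²` — NOT proved here, the genuine analytic input, displayed),
`θ := a∕m + b∕√m` controls everything: `(1 − θ)⟨C, Δ_{a,□}(1)C⟩ ≦ ⟨C, Δ_{a,□}(U′)C⟩ ≦ (1 + θ)⟨C, Δ_{a,□}(1)C⟩`, `⟨B, V(A)G_□(1)B⟩ ≦ θ⟨B, B⟩`.  Located from the
consumer side by seat `ym-inputs-p02` (cell `pub/ym-inputs`, I-06 (a); memo `pub/ym-inputs/THM33-G0-LOCATE-p02.md`): the R3 ∕ N06 knits read Cor. 3.6 per cube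
for `G_□(U)` (`Local342G`), whose positivity ∕ `L²` layer this is.

WHAT IS PROVED (sorry-free; 0 `def`; `M_N(ℂ)` fibres; weighted trace pairing `trIP w`, any `w > 0` in §1).
* §1 ENGINE (any finite carrier; `T₀`, `R`; `m > 0`, `a, b ≧ 0`, `θ := a∕m + b∕√m`): `sqrt_trIP_add_self_le`, `relBound_of_normBound` (an `L²` operator bound gives
  the relative form bound), `normBound_add` (`V = V₃ + P₁ + P₂`: bounds add), `trIP_energy_nonneg`, ★ `sqrt_mul_relBound_le_energy`,
  ★★ `trIP_sub_apply_self_ge_of_relBound` ∕ `…_le_…` (two-sided comparison of `T₀ − R` with `T₀`), ★★ `coercive_sub_of_relBound` (`(1 − θ)m⟨C,C⟩ ≦ ⟨C,(T₀ − R)C⟩`),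
  `posDefTr_sub_of_relBound`, `isUnit_sub_of_relBound`, `trIP_inverse_sub_le_of_relBound` (n06-w1's coercive engines BY NAME), ★★ `trIP_comp_rightInv_le_of_relBound` (`⟨B, R(G₀B)⟩ ≦ θ⟨B,B⟩` when `T₀G₀ = 1`), `trIP_comp_rightInv_lt_self_of_relBound`.
* §2 AT r05's CUBE LETTERS (`deltaACubeY`, `GACubeY`; ANY transporters, any `U₀`, `U′` for the comparison; `parSymY ∕ parBY`, base `1`, `0 < b₀` for `hV`):
  ★★ `deltaACubeY_energy_compare_of_relBound`, ★★★ `deltaACubeY_coercive_of_relBound`, ★★★ `deltaACubeY_posDefTr_of_relBound` (`Δ_{a,□}(U′) > 0`, `IsUnit`,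
  `G_□(U′) > 0`, `(1−θ)m⟨B, G_□(U′)B⟩ ≦ ⟨B,B⟩`, `((1−θ)m)²‖G_□(U′)B‖² ≦ ‖B‖²` — no symmetry, no `G`-valuedness used), ★★★ `hV_of_relBound` (r05's `hV`),
  ★★ `GACubeY_parSymY_posDefTr_of_relBoundGauge` (r05's road `GACubeY_parSymY_posDefTr_of_smallFieldGauge` fired from (i)+(ii) in a `G`-valued gauge).
* §3 `exists_coercive_deltaACubeY_parSymY_one` — input (i) for SOME `m > 0` (r05's positivity + dag-n06-j's `exists_pos_coer_of_posDefTr`).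

HONEST SCOPE.  Finite-dimensional form algebra (Cauchy–Schwarz, square roots) over landed letters; inputs (i) (with its constant) and (ii) are print's
ingredients of (3.84)–(3.86) for the cube sequence and are NOT proved here; no inequality of [B9] is asserted; the sup-norm ∕ `e^{−δd}` half of (3.85) is not
touched — `L²` only.  Count-neutral; NOT a node discharge; no summit or sub-problem statement is proved or implied (rungs R3∕R4 are conditional finite-lattice
bookkeeping; nothing continuum, nothing about OS axioms or the mass gap; not Clay).  No `sorry`∕`axiom`∕`instance`∕`notation`; NEW file, modifies nothing;
dag-n06-j's, n06-w1's and r05's decls used BY NAME.  Seat `ym-inputs-p02` (prover-ym-inputs-p02-0), 2026-08-28.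
-/



namespace Literature.MathematicalPhysics.QuantumFieldTheory.Balaban1983to89.B9Thm311CubeLettersGCoercive

open B9Thm311ReadingCoords B9Thm311DeltaPrimePos B9Thm31SiteGpBoundsReg335Y Node00 B9CubeLettersBondOpsL0
  B9CubeLettersBondOpsAtOneIdentL0 B9Thm311CubeLettersG B9Thm311CoercivePureGaugeAtLettersY
open Literature.MathematicalPhysics.QuantumFieldTheory.Balaban1983to89.B9Ineq349SiteAdjoint (trIP_comm)
open Literature.MathematicalPhysics.QuantumFieldTheory.Balaban1983to89.B9Eq3132CoerciveVariational (trIP_sub_right trIP_smul_right)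
open Literature.MathematicalPhysics.QuantumFieldTheory.Balaban1983to89.B6KLevelCensusIndexV1 (KIdx)
open Literature.MathematicalPhysics.QuantumFieldTheory.Balaban1983to89.B6Cover236MultiLevelBlocks (cubes)
open scoped Matrix

noncomputable section

/-! ## §1 The engine: a first-order relative bound against a coercive operator, in print's trace currency -/

section Engine

variable {S : Type} [Fintype S] {N : ℕ} {w : S → ℝ}
  {T₀ R R₁ R₂ : (S → Matrix (Fin N) (Fin N) ℂ) →ₗ[ℂ] (S → Matrix (Fin N) (Fin N) ℂ)} {m a b a₁ b₁ a₂ b₂ : ℝ}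

/-- the trace norm is subadditive: `‖Φ + Ψ‖_w ≦ ‖Φ‖_w + ‖Ψ‖_w` (read off dag-n06-j's orthonormal coordinates `realify311`).
[cite: Balaban1985BackgroundPropagators, p.393 (scalar products); folklore] -/
theorem sqrt_trIP_add_self_le (hw : ∀ s, 0 < w s) (Φ Ψ : S → Matrix (Fin N) (Fin N) ℂ) :
    Real.sqrt (trIP w (Φ + Ψ) (Φ + Ψ)) ≤ Real.sqrt (trIP w Φ Φ) + Real.sqrt (trIP w Ψ Ψ) := by
  have h : ∀ X : S → Matrix (Fin N) (Fin N) ℂ, Real.sqrt (trIP w X X) = ‖realify311 w hw X‖ := fun X => by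
    rw [← norm_sq_realify311 (w := w) (hw := hw) X, Real.sqrt_sq (norm_nonneg _)]
  rw [h, h, h, map_add]
  exact norm_add_le _ _

/-- **AN `L²` OPERATOR BOUND GIVES THE RELATIVE FORM BOUND** (Cauchy–Schwarz): `‖RC‖_w ≦ a‖C‖_w + b⟨C, T₀C⟩^{1/2}` for all `C` implies
`|⟨B, RC⟩_w| ≦ ‖B‖_w·(a‖C‖_w + b⟨C, T₀C⟩^{1/2})` — the shape in which print's (3.73)∕(3.77)∕(3.83) enter (3.85).
[cite: Balaban1985BackgroundPropagators, (3.84)–(3.85) p.407; folklore] -/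
theorem relBound_of_normBound (hw : ∀ s, 0 < w s)
    (hR : ∀ C, Real.sqrt (trIP w (R C) (R C)) ≤ a * Real.sqrt (trIP w C C) + b * Real.sqrt (trIP w C (T₀ C)))
    (B C : S → Matrix (Fin N) (Fin N) ℂ) :
    |trIP w B (R C)| ≤ Real.sqrt (trIP w B B) * (a * Real.sqrt (trIP w C C) + b * Real.sqrt (trIP w C (T₀ C))) :=
  le_trans (abs_trIP_le w hw B (R C)) (mul_le_mul_of_nonneg_left (hR C) (Real.sqrt_nonneg _))

/-- **RELATIVE BOUNDS ADD** (print's `V(A) = V₃(A) + P₁(A) + P₂(A)`, «the sum of these three operators»): `L²` bounds with constants `(a₁, b₁)`,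
`(a₂, b₂)` for `R₁`, `R₂` give `(a₁ + a₂, b₁ + b₂)` for `R₁ + R₂`. [cite: Balaban1985BackgroundPropagators, (3.82)–(3.84) p.407; folklore] -/
theorem normBound_add (hw : ∀ s, 0 < w s)
    (h₁ : ∀ C, Real.sqrt (trIP w (R₁ C) (R₁ C)) ≤ a₁ * Real.sqrt (trIP w C C) + b₁ * Real.sqrt (trIP w C (T₀ C)))
    (h₂ : ∀ C, Real.sqrt (trIP w (R₂ C) (R₂ C)) ≤ a₂ * Real.sqrt (trIP w C C) + b₂ * Real.sqrt (trIP w C (T₀ C)))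
    (C : S → Matrix (Fin N) (Fin N) ℂ) :
    Real.sqrt (trIP w ((R₁ + R₂) C) ((R₁ + R₂) C)) ≤ (a₁ + a₂) * Real.sqrt (trIP w C C) + (b₁ + b₂) * Real.sqrt (trIP w C (T₀ C)) := by
  rw [LinearMap.add_apply]
  refine le_trans (sqrt_trIP_add_self_le hw _ _) ?_
  have := add_le_add (h₁ C) (h₂ C)
  linarith

/-- under coercivity the energy `⟨C, T₀C⟩_w` is nonnegative. [cite: Balaban1984PropagatorsII, p.228 («The operator G is positive»); bookkeeping] -/
theorem trIP_energy_nonneg (hw : ∀ s, 0 < w s) (hm : 0 < m) (hco : ∀ Φ, m * trIP w Φ Φ ≤ trIP w Φ (T₀ Φ)) (Ψ : S → Matrix (Fin N) (Fin N) ℂ) :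
    0 ≤ trIP w Ψ (T₀ Ψ) :=
  le_trans (mul_nonneg hm.le (trIP_self_nonneg w hw Ψ)) (hco Ψ)

/-- ★ **THE SCALE BOOKKEEPING OF (3.85)**: under `m‖C‖² ≦ ⟨C, T₀C⟩`, `‖C‖·(a‖C‖ + b⟨C,T₀C⟩^{1/2}) ≦ (a∕m + b∕√m)·⟨C, T₀C⟩` — the first-order term costs
`b∕√m`, the zeroth-order term `a∕m` (print: `V₃` is `O(α₁(Lʲη)⁻¹)·∇ + O(α₁(Lʲη)⁻²)` against `m = O(1)(Lʲη)⁻²`, net `O(1)α₁`).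
[cite: Balaban1985BackgroundPropagators, (3.73) p.404, (3.85) p.407; folklore] -/
theorem sqrt_mul_relBound_le_energy (hw : ∀ s, 0 < w s) (hm : 0 < m) (ha : 0 ≤ a) (hb : 0 ≤ b)
    (hco : ∀ Φ, m * trIP w Φ Φ ≤ trIP w Φ (T₀ Φ)) (Ψ : S → Matrix (Fin N) (Fin N) ℂ) :
    Real.sqrt (trIP w Ψ Ψ) * (a * Real.sqrt (trIP w Ψ Ψ) + b * Real.sqrt (trIP w Ψ (T₀ Ψ))) ≤
      (a / m + b / Real.sqrt m) * trIP w Ψ (T₀ Ψ) := by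
  set q := trIP w Ψ Ψ
  set E := trIP w Ψ (T₀ Ψ)
  have hq : 0 ≤ q := trIP_self_nonneg w hw Ψ; have hE : m * q ≤ E := hco Ψ
  have hE0 : 0 ≤ E := le_trans (mul_nonneg hm.le hq) hE
  have hsm : 0 < Real.sqrt m := Real.sqrt_pos.mpr hm; have h1 : Real.sqrt q * Real.sqrt q = q := Real.mul_self_sqrt hq
  have h2 : Real.sqrt q * Real.sqrt m ≤ Real.sqrt E := by
    rw [← Real.sqrt_mul hq]
    exact Real.sqrt_le_sqrt (by nlinarith)
  have h3 : Real.sqrt q * Real.sqrt E ≤ E / Real.sqrt m := by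
    rw [le_div_iff₀ hsm]
    calc Real.sqrt q * Real.sqrt E * Real.sqrt m = (Real.sqrt q * Real.sqrt m) * Real.sqrt E := by ring
      _ ≤ Real.sqrt E * Real.sqrt E := mul_le_mul_of_nonneg_right h2 (Real.sqrt_nonneg _)
      _ = E := Real.mul_self_sqrt hE0
  have h4 : q ≤ E / m := by rw [le_div_iff₀ hm]; linarith
  calc Real.sqrt q * (a * Real.sqrt q + b * Real.sqrt E)
        = a * (Real.sqrt q * Real.sqrt q) + b * (Real.sqrt q * Real.sqrt E) := by ring
    _ = a * q + b * (Real.sqrt q * Real.sqrt E) := by rw [h1]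
    _ ≤ a * (E / m) + b * (E / Real.sqrt m) :=
        add_le_add (mul_le_mul_of_nonneg_left h4 ha) (mul_le_mul_of_nonneg_left h3 hb)
    _ = (a / m + b / Real.sqrt m) * E := by ring

/-- ★★ **THE PERTURBED OPERATOR AGAINST THE UNPERTURBED ONE, LOWER** («Δ_a(U′U) = Δ_a(U) − V(A)» (3.84)): `(1 − θ)⟨C, T₀C⟩ ≦ ⟨C, (T₀ − R)C⟩`,
`θ = a∕m + b∕√m`. [cite: Balaban1985BackgroundPropagators, (3.84) p.407, Thm 3.11 p.416] -/
theorem trIP_sub_apply_self_ge_of_relBound (hw : ∀ s, 0 < w s) (hm : 0 < m) (ha : 0 ≤ a) (hb : 0 ≤ b)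
    (hco : ∀ Φ, m * trIP w Φ Φ ≤ trIP w Φ (T₀ Φ)) (hrel : ∀ Φ Ψ, |trIP w Φ (R Ψ)| ≤
      Real.sqrt (trIP w Φ Φ) * (a * Real.sqrt (trIP w Ψ Ψ) + b * Real.sqrt (trIP w Ψ (T₀ Ψ))))
    (Φ : S → Matrix (Fin N) (Fin N) ℂ) :
    (1 - (a / m + b / Real.sqrt m)) * trIP w Φ (T₀ Φ) ≤ trIP w Φ ((T₀ - R) Φ) := by
  have h := sqrt_mul_relBound_le_energy hw hm ha hb hco Φ
  have hR : trIP w Φ (R Φ) ≤ (a / m + b / Real.sqrt m) * trIP w Φ (T₀ Φ) :=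
    le_trans (le_trans (le_abs_self _) (hrel Φ Φ)) h
  rw [LinearMap.sub_apply, trIP_sub_right]
  linarith

/-- ★★ **… AND UPPER**: `⟨C, (T₀ − R)C⟩ ≦ (1 + θ)⟨C, T₀C⟩`. [cite: Balaban1985BackgroundPropagators, (3.84) p.407, Thm 3.11 p.416] -/
theorem trIP_sub_apply_self_le_of_relBound (hw : ∀ s, 0 < w s) (hm : 0 < m) (ha : 0 ≤ a) (hb : 0 ≤ b)
    (hco : ∀ Φ, m * trIP w Φ Φ ≤ trIP w Φ (T₀ Φ)) (hrel : ∀ Φ Ψ, |trIP w Φ (R Ψ)| ≤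
      Real.sqrt (trIP w Φ Φ) * (a * Real.sqrt (trIP w Ψ Ψ) + b * Real.sqrt (trIP w Ψ (T₀ Ψ))))
    (Φ : S → Matrix (Fin N) (Fin N) ℂ) :
    trIP w Φ ((T₀ - R) Φ) ≤ (1 + (a / m + b / Real.sqrt m)) * trIP w Φ (T₀ Φ) := by
  have h := sqrt_mul_relBound_le_energy hw hm ha hb hco Φ
  have hR : -trIP w Φ (R Φ) ≤ (a / m + b / Real.sqrt m) * trIP w Φ (T₀ Φ) :=
    le_trans (le_trans (neg_le_abs _) (hrel Φ Φ)) h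
  rw [LinearMap.sub_apply, trIP_sub_right]
  linarith

/-- ★★ **COERCIVITY SURVIVES A SMALL FIRST-ORDER PERTURBATION**: for `θ = a∕m + b∕√m ≦ 1`, `(1 − θ)m·⟨C, C⟩ ≦ ⟨C, (T₀ − R)C⟩` — the `L²` content of
«Δ_a(U′U) = (I − V(A)G(U))Δ_a(U)» with «V(A)G(U) … a small operator». [cite: Balaban1985BackgroundPropagators, (3.84)–(3.86) p.407, Thm 3.11 p.416] -/
theorem coercive_sub_of_relBound (hw : ∀ s, 0 < w s) (hm : 0 < m) (ha : 0 ≤ a) (hb : 0 ≤ b)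
    (hco : ∀ Φ, m * trIP w Φ Φ ≤ trIP w Φ (T₀ Φ)) (hrel : ∀ Φ Ψ, |trIP w Φ (R Ψ)| ≤
      Real.sqrt (trIP w Φ Φ) * (a * Real.sqrt (trIP w Ψ Ψ) + b * Real.sqrt (trIP w Ψ (T₀ Ψ))))
    (hθ : a / m + b / Real.sqrt m ≤ 1) (Φ : S → Matrix (Fin N) (Fin N) ℂ) :
    ((1 - (a / m + b / Real.sqrt m)) * m) * trIP w Φ Φ ≤ trIP w Φ ((T₀ - R) Φ) := by
  have h := trIP_sub_apply_self_ge_of_relBound hw hm ha hb hco hrel Φ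
  have h1 : 0 ≤ 1 - (a / m + b / Real.sqrt m) := by linarith
  calc ((1 - (a / m + b / Real.sqrt m)) * m) * trIP w Φ Φ
        = (1 - (a / m + b / Real.sqrt m)) * (m * trIP w Φ Φ) := by ring
    _ ≤ (1 - (a / m + b / Real.sqrt m)) * trIP w Φ (T₀ Φ) := mul_le_mul_of_nonneg_left (hco Φ) h1
    _ ≤ _ := h

/-- for `θ < 1` the perturbed operator `T₀ − R` is positive definite (print: «we prove positivity of G_□» — here for `Δ_{a,□} = G_□⁻¹` directly).
[cite: Balaban1985BackgroundPropagators, Thm 3.11 p.416, (3.84) p.407] -/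
theorem posDefTr_sub_of_relBound (hw : ∀ s, 0 < w s) (hm : 0 < m) (ha : 0 ≤ a) (hb : 0 ≤ b)
    (hco : ∀ Φ, m * trIP w Φ Φ ≤ trIP w Φ (T₀ Φ)) (hrel : ∀ Φ Ψ, |trIP w Φ (R Ψ)| ≤
      Real.sqrt (trIP w Φ Φ) * (a * Real.sqrt (trIP w Ψ Ψ) + b * Real.sqrt (trIP w Ψ (T₀ Ψ))))
    (hθ : a / m + b / Real.sqrt m < 1) : PosDefTr w (T₀ - R) :=
  posDefTr_of_coercive hw (mul_pos (by linarith) hm) (coercive_sub_of_relBound hw hm ha hb hco hrel hθ.le)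

/-- … hence a unit («G(U′U) = G(U)(I − V(A)G(U))⁻¹» exists as a genuine two-sided inverse). [cite: Balaban1985BackgroundPropagators, (3.86) p.407, (3.27) p.395] -/
theorem isUnit_sub_of_relBound (hw : ∀ s, 0 < w s) (hm : 0 < m) (ha : 0 ≤ a) (hb : 0 ≤ b)
    (hco : ∀ Φ, m * trIP w Φ Φ ≤ trIP w Φ (T₀ Φ)) (hrel : ∀ Φ Ψ, |trIP w Φ (R Ψ)| ≤
      Real.sqrt (trIP w Φ Φ) * (a * Real.sqrt (trIP w Ψ Ψ) + b * Real.sqrt (trIP w Ψ (T₀ Ψ))))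
    (hθ : a / m + b / Real.sqrt m < 1) : IsUnit (T₀ - R) :=
  isUnit_of_coercive hw (mul_pos (by linarith) hm) (coercive_sub_of_relBound hw hm ha hb hco hrel hθ.le)

/-- ★ **THE INVERSE OF THE PERTURBED OPERATOR AS A FORM**: `(1 − θ)m·⟨B, (T₀ − R)⁻¹B⟩ ≦ ⟨B, B⟩` («G(U′U) … convergence is in the operator norm»; n06-w1's
`trIP_ringInverse_le` by name). [cite: Balaban1985BackgroundPropagators, (3.86) p.407, Thm 3.3 p.399 ((3.46)₁ in `L²`)] -/
theorem trIP_inverse_sub_le_of_relBound (hw : ∀ s, 0 < w s) (hm : 0 < m) (ha : 0 ≤ a) (hb : 0 ≤ b)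
    (hco : ∀ Φ, m * trIP w Φ Φ ≤ trIP w Φ (T₀ Φ)) (hrel : ∀ Φ Ψ, |trIP w Φ (R Ψ)| ≤
      Real.sqrt (trIP w Φ Φ) * (a * Real.sqrt (trIP w Ψ Ψ) + b * Real.sqrt (trIP w Ψ (T₀ Ψ))))
    (hθ : a / m + b / Real.sqrt m < 1) (Ψ : S → Matrix (Fin N) (Fin N) ℂ) :
    ((1 - (a / m + b / Real.sqrt m)) * m) * trIP w Ψ (Ring.inverse (T₀ - R) Ψ) ≤ trIP w Ψ Ψ :=
  trIP_ringInverse_le hw (mul_pos (by linarith) hm) (coercive_sub_of_relBound hw hm ha hb hco hrel hθ.le) Ψ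

/-- ★★ **«V(A)G(U) IS A SMALL OPERATOR» IN `L²`** ((3.85)∕(3.86), form version): if `T₀G₀ = I` pointwise (`G₀ = G(U)` the inverse of the unperturbed
operator), then `⟨B, R(G₀B)⟩ ≦ θ·⟨B, B⟩`, `θ = a∕m + b∕√m` — EXACTLY the θ-form of r05's ∕ dag-n06-j's displayed smallness hypotheses
(`deltaACubeY_parSymY_posDefTr_of_small_le`, `posDefTr_of_mul_eq_one_sub_of_le`). [cite: Balaban1985BackgroundPropagators, (3.85)–(3.86) p.407, Thm 3.11 p.416] -/
theorem trIP_comp_rightInv_le_of_relBound (hw : ∀ s, 0 < w s) (hm : 0 < m) (ha : 0 ≤ a) (hb : 0 ≤ b)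
    (hco : ∀ Φ, m * trIP w Φ Φ ≤ trIP w Φ (T₀ Φ)) (hrel : ∀ Φ Ψ, |trIP w Φ (R Ψ)| ≤
      Real.sqrt (trIP w Φ Φ) * (a * Real.sqrt (trIP w Ψ Ψ) + b * Real.sqrt (trIP w Ψ (T₀ Ψ))))
    {G₀ : (S → Matrix (Fin N) (Fin N) ℂ) →ₗ[ℂ] (S → Matrix (Fin N) (Fin N) ℂ)}
    (hG₀ : ∀ Ψ, T₀ (G₀ Ψ) = Ψ) (Ψ : S → Matrix (Fin N) (Fin N) ℂ) :
    trIP w Ψ (R (G₀ Ψ)) ≤ (a / m + b / Real.sqrt m) * trIP w Ψ Ψ := by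
  set Φ := G₀ Ψ with hΦdef
  set q := trIP w Φ Φ
  set p := trIP w Ψ Ψ
  have hq : 0 ≤ q := trIP_self_nonneg w hw Φ; have hp : 0 ≤ p := trIP_self_nonneg w hw Ψ
  have hEeq : trIP w Φ (T₀ Φ) = trIP w Φ Ψ := by rw [hΦdef, hG₀]
  have hE : m * q ≤ trIP w Φ Ψ := hEeq ▸ hco Φ
  have hE0 : 0 ≤ trIP w Φ Ψ := le_trans (mul_nonneg hm.le hq) hE
  have hCS : trIP w Φ Ψ ^ 2 ≤ q * p := trIP_sq_le w hw Φ Ψ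
  -- `E ≦ p∕m` and `q ≦ p∕m²`
  have hEp : trIP w Φ Ψ ≤ p / m := by
    rw [le_div_iff₀ hm]
    rcases hE0.eq_or_lt with h0 | hpos
    · rw [← h0, zero_mul]; exact hp
    · rcases hq.eq_or_lt with hq0 | hqpos
      · exfalso; have : trIP w Φ Ψ ^ 2 ≤ 0 := by rw [← hq0, zero_mul] at hCS; exact hCS
        nlinarith
      · exact le_of_mul_le_mul_right (by nlinarith : trIP w Φ Ψ * m * q ≤ p * q) hqpos
  have hqp : q ≤ p / m ^ 2 := by
    rw [le_div_iff₀ (pow_pos hm 2)]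
    have h5 : m * q * m ≤ p := (le_div_iff₀ hm).mp (hE.trans hEp)
    calc q * m ^ 2 = m * q * m := by ring
      _ ≤ p := h5
  have hsm : 0 < Real.sqrt m := Real.sqrt_pos.mpr hm
  have hsq : Real.sqrt q ≤ Real.sqrt p / m := by
    rw [← Real.sqrt_sq hm.le, ← Real.sqrt_div hp]; exact Real.sqrt_le_sqrt hqp
  have hsE : Real.sqrt (trIP w Φ (T₀ Φ)) ≤ Real.sqrt p / Real.sqrt m := by
    rw [hEeq, ← Real.sqrt_div hp]; exact Real.sqrt_le_sqrt hEp
  have hpp : Real.sqrt p * Real.sqrt p = p := Real.mul_self_sqrt hp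
  calc trIP w Ψ (R Φ) ≤ |trIP w Ψ (R Φ)| := le_abs_self _
    _ ≤ Real.sqrt p * (a * Real.sqrt q + b * Real.sqrt (trIP w Φ (T₀ Φ))) := hrel Ψ Φ
    _ ≤ Real.sqrt p * (a * (Real.sqrt p / m) + b * (Real.sqrt p / Real.sqrt m)) := by
        refine mul_le_mul_of_nonneg_left ?_ (Real.sqrt_nonneg _)
        exact add_le_add (mul_le_mul_of_nonneg_left hsq ha) (mul_le_mul_of_nonneg_left hsE hb)
    _ = (a / m + b / Real.sqrt m) * (Real.sqrt p * Real.sqrt p) := by ring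
    _ = (a / m + b / Real.sqrt m) * p := by rw [hpp]

/-- ★★ the strict form for `θ < 1`: `⟨B, R(G₀B)⟩ < ⟨B, B⟩` for `B ≠ 0` — the shape of r05's `hV` ∕ dag-n06-j's `posDefTr_of_mul_eq_one_sub`.
[cite: Balaban1985BackgroundPropagators, (3.85)–(3.86) p.407, Thm 3.11 p.416 («R is an operator with small norm»)] -/
theorem trIP_comp_rightInv_lt_self_of_relBound (hw : ∀ s, 0 < w s) (hm : 0 < m) (ha : 0 ≤ a) (hb : 0 ≤ b)
    (hco : ∀ Φ, m * trIP w Φ Φ ≤ trIP w Φ (T₀ Φ)) (hrel : ∀ Φ Ψ, |trIP w Φ (R Ψ)| ≤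
      Real.sqrt (trIP w Φ Φ) * (a * Real.sqrt (trIP w Ψ Ψ) + b * Real.sqrt (trIP w Ψ (T₀ Ψ))))
    {G₀ : (S → Matrix (Fin N) (Fin N) ℂ) →ₗ[ℂ] (S → Matrix (Fin N) (Fin N) ℂ)}
    (hG₀ : ∀ Ψ, T₀ (G₀ Ψ) = Ψ) (hθ : a / m + b / Real.sqrt m < 1) {Ψ : S → Matrix (Fin N) (Fin N) ℂ} (hΨ : Ψ ≠ 0) :
    trIP w Ψ (R (G₀ Ψ)) < trIP w Ψ Ψ := by
  have h := trIP_comp_rightInv_le_of_relBound hw hm ha hb hco hrel hG₀ Ψ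
  have hpos := trIP_self_pos w hw hΨ
  nlinarith

end Engine

/-! ## §2 At r05's cube letters: `T₀ = Δ_{a,□}(U₀)`, `T₀ − R = Δ_{a,□}(U′)`, `G₀ = G_□(U₀)` -/

section CubeLetters

open scoped Matrix.Norms.L2Operator

variable {d ℓ : ℕ} {hd : 1 ≤ d + 1} {hL : Odd (ℓ + 1) ∧ 1 < ℓ + 1} {b₀ b₁ : ℝ} {N : ℕ}
variable (i : KIdx d ℓ hd hL b₀ b₁) (q : ↥(cubes (toKT i).D.toDomains))

/-- the algebra of (3.84) for the cube letters: `Δ_{a,□}(U₀) − (Δ_{a,□}(U₀) − Δ_{a,□}(U′)) = Δ_{a,□}(U′)`, i.e. `Δ_a(U′U) = Δ_a(U) − V(A)` with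
`V(A) := Δ_{a,□}(U₀) − Δ_{a,□}(U′)`. [cite: Balaban1985BackgroundPropagators, (3.84) p.407, bookkeeping] -/
theorem deltaACubeY_eq_sub_V (parS : SiteParY (Matrix (Fin N) (Fin N) ℂ) i) (parB : BondParY (Matrix (Fin N) (Fin N) ℂ) i)
    (U₀ U' : CfgY (Matrix (Fin N) (Fin N) ℂ) i) :
    deltaACubeY i q parS parB U₀ - (deltaACubeY i q parS parB U₀ - deltaACubeY i q parS parB U') = deltaACubeY i q parS parB U' :=
  sub_sub_cancel _ _

/-- ★★ **`Δ_{a,□}(U′)` IS ENERGY-COMPARABLE TO `Δ_{a,□}(U₀)`**: `(1 − θ)⟨C, Δ_{a,□}(U₀)C⟩ ≦ ⟨C, Δ_{a,□}(U′)C⟩ ≦ (1 + θ)⟨C, Δ_{a,□}(U₀)C⟩` from (i) a coercivity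
`m⟨C,C⟩ ≦ ⟨C, Δ_{a,□}(U₀)C⟩` and (ii) the first-order relative bound of `V(A) = Δ_{a,□}(U₀) − Δ_{a,□}(U′)` with constants `(a, b)`, `θ = a∕m + b∕√m`
(ANY transporter letters, ANY two backgrounds). [cite: Balaban1985BackgroundPropagators, (3.84)–(3.86) p.407, Thm 3.11 p.416] -/
theorem deltaACubeY_energy_compare_of_relBound (parS : SiteParY (Matrix (Fin N) (Fin N) ℂ) i) (parB : BondParY (Matrix (Fin N) (Fin N) ℂ) i)
    (U₀ U' : CfgY (Matrix (Fin N) (Fin N) ℂ) i) {m a b : ℝ} (hm : 0 < m) (ha : 0 ≤ a) (hb : 0 ≤ b)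
    (hco : ∀ C, m * trIP (fun _ => (1 : ℝ)) C C ≤ trIP (fun _ => (1 : ℝ)) C (deltaACubeY i q parS parB U₀ C))
    (hrel : ∀ B C, |trIP (fun _ => (1 : ℝ)) B ((deltaACubeY i q parS parB U₀ - deltaACubeY i q parS parB U') C)| ≤ Real.sqrt (trIP (fun _ => (1 : ℝ)) B B) *
      (a * Real.sqrt (trIP (fun _ => (1 : ℝ)) C C) + b * Real.sqrt (trIP (fun _ => (1 : ℝ)) C (deltaACubeY i q parS parB U₀ C))))
    (C : FBondY i → Matrix (Fin N) (Fin N) ℂ) :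
    (1 - (a / m + b / Real.sqrt m)) * trIP (fun _ => (1 : ℝ)) C (deltaACubeY i q parS parB U₀ C) ≤
        trIP (fun _ => (1 : ℝ)) C (deltaACubeY i q parS parB U' C) ∧
      trIP (fun _ => (1 : ℝ)) C (deltaACubeY i q parS parB U' C) ≤
        (1 + (a / m + b / Real.sqrt m)) * trIP (fun _ => (1 : ℝ)) C (deltaACubeY i q parS parB U₀ C) := by
  have h1 := trIP_sub_apply_self_ge_of_relBound (fun _ => one_pos) hm ha hb hco hrel C
  have h2 := trIP_sub_apply_self_le_of_relBound (fun _ => one_pos) hm ha hb hco hrel C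
  rw [deltaACubeY_eq_sub_V] at h1 h2
  exact ⟨h1, h2⟩

/-- ★★★ **`Δ_{a,□}(U′)` IS COERCIVE**: `(1 − θ)m·⟨C, C⟩ ≦ ⟨C, Δ_{a,□}(U′)C⟩` for `θ = a∕m + b∕√m ≦ 1` — Theorem 3.11's positivity for the cube letter WITH ITS
CONSTANT, from (i) + (ii); no symmetry and no `G`-valuedness of `U′` is used. [cite: Balaban1985BackgroundPropagators, Thm 3.11 p.416, (3.84)–(3.86) p.407, p.409 l.3–5] -/
theorem deltaACubeY_coercive_of_relBound (parS : SiteParY (Matrix (Fin N) (Fin N) ℂ) i) (parB : BondParY (Matrix (Fin N) (Fin N) ℂ) i)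
    (U₀ U' : CfgY (Matrix (Fin N) (Fin N) ℂ) i) {m a b : ℝ} (hm : 0 < m) (ha : 0 ≤ a) (hb : 0 ≤ b)
    (hco : ∀ C, m * trIP (fun _ => (1 : ℝ)) C C ≤ trIP (fun _ => (1 : ℝ)) C (deltaACubeY i q parS parB U₀ C))
    (hrel : ∀ B C, |trIP (fun _ => (1 : ℝ)) B ((deltaACubeY i q parS parB U₀ - deltaACubeY i q parS parB U') C)| ≤ Real.sqrt (trIP (fun _ => (1 : ℝ)) B B) *
      (a * Real.sqrt (trIP (fun _ => (1 : ℝ)) C C) + b * Real.sqrt (trIP (fun _ => (1 : ℝ)) C (deltaACubeY i q parS parB U₀ C))))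
    (hθ : a / m + b / Real.sqrt m ≤ 1) (C : FBondY i → Matrix (Fin N) (Fin N) ℂ) :
    ((1 - (a / m + b / Real.sqrt m)) * m) * trIP (fun _ => (1 : ℝ)) C C ≤ trIP (fun _ => (1 : ℝ)) C (deltaACubeY i q parS parB U' C) := by
  have h := coercive_sub_of_relBound (fun _ => one_pos) hm ha hb hco hrel hθ C
  rwa [deltaACubeY_eq_sub_V] at h

/-- ★★★ **THEOREM 3.11 FOR THE CUBE LETTERS FROM (i) + (ii)**, `θ < 1`: `Δ_{a,□}(U′)` is positive definite and invertible, `G_□(U′) = Δ_{a,□}(U′)⁻¹` is positive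
definite, and «G(U′U) … convergence in the operator norm» in `L²`: `(1 − θ)m·⟨B, G_□(U′)B⟩ ≦ ⟨B, B⟩`, `((1 − θ)m)²·‖G_□(U′)B‖² ≦ ‖B‖²`.
[cite: Balaban1985BackgroundPropagators, Thm 3.11 p.416, (3.86) p.407, (3.27) p.395, p.409 l.3–5] -/
theorem deltaACubeY_posDefTr_of_relBound (parS : SiteParY (Matrix (Fin N) (Fin N) ℂ) i) (parB : BondParY (Matrix (Fin N) (Fin N) ℂ) i)
    (U₀ U' : CfgY (Matrix (Fin N) (Fin N) ℂ) i) {m a b : ℝ} (hm : 0 < m) (ha : 0 ≤ a) (hb : 0 ≤ b)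
    (hco : ∀ C, m * trIP (fun _ => (1 : ℝ)) C C ≤ trIP (fun _ => (1 : ℝ)) C (deltaACubeY i q parS parB U₀ C))
    (hrel : ∀ B C, |trIP (fun _ => (1 : ℝ)) B ((deltaACubeY i q parS parB U₀ - deltaACubeY i q parS parB U') C)| ≤ Real.sqrt (trIP (fun _ => (1 : ℝ)) B B) *
      (a * Real.sqrt (trIP (fun _ => (1 : ℝ)) C C) + b * Real.sqrt (trIP (fun _ => (1 : ℝ)) C (deltaACubeY i q parS parB U₀ C))))
    (hθ : a / m + b / Real.sqrt m < 1) :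
    PosDefTr (fun _ => (1 : ℝ)) (deltaACubeY i q parS parB U') ∧ IsUnit (deltaACubeY i q parS parB U') ∧
      PosDefTr (fun _ => (1 : ℝ)) (GACubeY i q parS parB U') ∧
      (∀ B : FBondY i → Matrix (Fin N) (Fin N) ℂ,
        ((1 - (a / m + b / Real.sqrt m)) * m) * trIP (fun _ => (1 : ℝ)) B (GACubeY i q parS parB U' B) ≤ trIP (fun _ => (1 : ℝ)) B B) ∧
      (∀ B : FBondY i → Matrix (Fin N) (Fin N) ℂ,
        ((1 - (a / m + b / Real.sqrt m)) * m) ^ 2 * trIP (fun _ => (1 : ℝ)) (GACubeY i q parS parB U' B) (GACubeY i q parS parB U' B) ≤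
          trIP (fun _ => (1 : ℝ)) B B) := by
  have hw : ∀ _ : FBondY i, (0 : ℝ) < 1 := fun _ => one_pos
  have hm' : 0 < (1 - (a / m + b / Real.sqrt m)) * m := mul_pos (by linarith) hm
  have hco' := deltaACubeY_coercive_of_relBound i q parS parB U₀ U' hm ha hb hco hrel hθ.le
  have hpos : PosDefTr (fun _ => (1 : ℝ)) (deltaACubeY i q parS parB U') := posDefTr_of_coercive hw hm' hco'
  refine ⟨hpos, isUnit_of_posDefTr hpos, posDefTr_ringInverse hpos, fun B => ?_, fun B => ?_⟩
  · exact trIP_ringInverse_le hw hm' hco' B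
  · exact trIP_ringInverse_self_le hw hm' hco' B

variable {G : Subgroup (Matrix (Fin N) (Fin N) ℂ)ˣ}

/-- ★★★ **r05's DISPLAYED `hV` FOLLOWS FROM (i) + (ii)**: at the `U = 1` base with def-Y's v4 transporters (`0 < b₀`, so that `Δ_{a,□}(1)G_□(1) = 1`,
`B9CubeLettersBondOpsAtOneIdentL0.deltaACubeY_one_mul_GACubeY_one`), a flat coercivity constant `m` and a relative bound `(a, b)` of
`V(A) = Δ_{a,□}(1) − Δ_{a,□}(U′)` with `a∕m + b∕√m < 1` give `⟨B, V(A)G_□(1)B⟩ < ⟨B, B⟩` for `B ≠ 0` — the hypothesis `hV` of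
`B9Thm311CubeLettersG.deltaACubeY_parSymY_posDefTr_of_small` ∕ `GACubeY_parSymY_posDefTr_of_smallFieldGauge` VERBATIM.
[cite: Balaban1985BackgroundPropagators, (3.84)–(3.86) p.407, Thm 3.11 p.416; Balaban1984PropagatorsII, (2.22) p.226, p.228] -/
theorem hV_of_relBound (hb₀ : 0 < b₀) (U' : CfgY (Matrix (Fin N) (Fin N) ℂ) i) {m a b : ℝ} (hm : 0 < m) (ha : 0 ≤ a) (hb : 0 ≤ b)
    (hco : ∀ C, m * trIP (fun _ => (1 : ℝ)) C C ≤
      trIP (fun _ => (1 : ℝ)) C (deltaACubeY i q (parSymY i) (parBY i) (fun _ _ => 1 : CfgY (Matrix (Fin N) (Fin N) ℂ) i) C))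
    (hrel : ∀ B C, |trIP (fun _ => (1 : ℝ)) B
        ((deltaACubeY i q (parSymY i) (parBY i) (fun _ _ => 1 : CfgY (Matrix (Fin N) (Fin N) ℂ) i) - deltaACubeY i q (parSymY i) (parBY i) U') C)| ≤
      Real.sqrt (trIP (fun _ => (1 : ℝ)) B B) * (a * Real.sqrt (trIP (fun _ => (1 : ℝ)) C C) +
        b * Real.sqrt (trIP (fun _ => (1 : ℝ)) C (deltaACubeY i q (parSymY i) (parBY i) (fun _ _ => 1 : CfgY (Matrix (Fin N) (Fin N) ℂ) i) C))))
    (hθ : a / m + b / Real.sqrt m < 1) (B : FBondY i → Matrix (Fin N) (Fin N) ℂ) (hB : B ≠ 0) :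
    trIP (fun _ => (1 : ℝ)) B
        ((deltaACubeY i q (parSymY i) (parBY i) (fun _ _ => 1 : CfgY (Matrix (Fin N) (Fin N) ℂ) i) - deltaACubeY i q (parSymY i) (parBY i) U')
          (GACubeY i q (parSymY i) (parBY i) (fun _ _ => 1 : CfgY (Matrix (Fin N) (Fin N) ℂ) i) B)) <
      trIP (fun _ => (1 : ℝ)) B B := by
  have h1 := deltaACubeY_one_mul_GACubeY_one i q hb₀ (fun z w => parSymY_one (𝔸 := Matrix (Fin N) (Fin N) ℂ) i z w)
    (fun s s' => parBY_one (𝔸 := Matrix (Fin N) (Fin N) ℂ) i s s')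
  have hG₀ : ∀ Ψ, deltaACubeY i q (parSymY i) (parBY i) (fun _ _ => 1 : CfgY (Matrix (Fin N) (Fin N) ℂ) i)
      (GACubeY i q (parSymY i) (parBY i) (fun _ _ => 1 : CfgY (Matrix (Fin N) (Fin N) ℂ) i) Ψ) = Ψ := fun Ψ => (LinearMap.ext_iff.mp h1) Ψ
  exact trIP_comp_rightInv_lt_self_of_relBound (fun _ => one_pos) hm ha hb hco hrel hG₀ hθ hB

/-- ★★ **r05's ROAD FIRED FROM (i) + (ii)**: for a `G`-valued `U` (`G ≦ U(N)`) and a `G`-valued gauge `u` («Doing the gauge transformation we get the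
configuration U = e^{iηA} with A small») at which `V(A) = Δ_{a,□}(1) − Δ_{a,□}(U^u)` has a relative bound `(a, b)` with `a∕m + b∕√m < 1` against a flat
coercivity constant `m`: `Δ_{a,□}(U) > 0`, `IsUnit`, `G_□(U) > 0` at the ORIGINAL `U` — `B9Thm311CubeLettersG.GACubeY_parSymY_posDefTr_of_smallFieldGauge` with
its `hV` supplied by `hV_of_relBound`. [cite: Balaban1985BackgroundPropagators, Thm 3.11 p.416 (last paragraph), (3.84)–(3.86) p.407, Cor. 3.6 p.408, (3.35) p.396] -/
theorem GACubeY_parSymY_posDefTr_of_relBoundGauge (hb₀ : 0 < b₀) (hG : G ≤ B7Prop2Explicit.unitaryUnits (Matrix (Fin N) (Fin N) ℂ))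
    {U : CfgY (Matrix (Fin N) (Fin N) ℂ) i} (hU : ∀ μ x, U μ x ∈ G) {m : ℝ} (hm : 0 < m)
    (hco : ∀ C, m * trIP (fun _ => (1 : ℝ)) C C ≤
      trIP (fun _ => (1 : ℝ)) C (deltaACubeY i q (parSymY i) (parBY i) (fun _ _ => 1 : CfgY (Matrix (Fin N) (Fin N) ℂ) i) C))
    (h : ∃ u : GaugeY (Matrix (Fin N) (Fin N) ℂ) i, (∀ x, u x ∈ G) ∧ ∃ a b : ℝ, 0 ≤ a ∧ 0 ≤ b ∧ a / m + b / Real.sqrt m < 1 ∧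
      ∀ B C, |trIP (fun _ => (1 : ℝ)) B
          ((deltaACubeY i q (parSymY i) (parBY i) (fun _ _ => 1 : CfgY (Matrix (Fin N) (Fin N) ℂ) i) -
            deltaACubeY i q (parSymY i) (parBY i) (gaugeY i u U)) C)| ≤
        Real.sqrt (trIP (fun _ => (1 : ℝ)) B B) * (a * Real.sqrt (trIP (fun _ => (1 : ℝ)) C C) +
          b * Real.sqrt (trIP (fun _ => (1 : ℝ)) C (deltaACubeY i q (parSymY i) (parBY i) (fun _ _ => 1 : CfgY (Matrix (Fin N) (Fin N) ℂ) i) C))))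
    :
    PosDefTr (fun _ => (1 : ℝ)) (deltaACubeY i q (parSymY i) (parBY i) U) ∧ IsUnit (deltaACubeY i q (parSymY i) (parBY i) U) ∧
      PosDefTr (fun _ => (1 : ℝ)) (GACubeY i q (parSymY i) (parBY i) U) := by
  obtain ⟨u, hu, a, b, ha, hb, hθ, hrel⟩ := h
  exact GACubeY_parSymY_posDefTr_of_smallFieldGauge i hb₀ hG q hU
    ⟨u, hu, fun B hB => hV_of_relBound i q hb₀ (gaugeY i u U) hm ha hb hco hrel hθ B hB⟩

end CubeLetters

/-! ## §3 Input (i) qualitatively: SOME flat coercivity constant exists -/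

section Qualitative

open scoped Matrix.Norms.L2Operator

variable {d ℓ : ℕ} {hd : 1 ≤ d + 1} {hL : Odd (ℓ + 1) ∧ 1 < ℓ + 1} {b₀ b₁ : ℝ} {N : ℕ}
variable (i : KIdx d ℓ hd hL b₀ b₁) (q : ↥(cubes (toKT i).D.toDomains))

/-- **INPUT (i) HOLDS FOR SOME CONSTANT**: `∃ m > 0, m⟨C, C⟩ ≦ ⟨C, Δ_{a,□}(1)C⟩` at def-Y's v4 transporters — r05's `deltaACubeY_parSymY_one_posDefTr` ([4] p. 228)
through dag-n06-j's compactness lemma `exists_pos_coer_of_posDefTr`.  QUALITATIVE on purpose: print's constant is `O(1)(Lʲη)⁻²` ([4] (2.22)), not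
located here. [cite: Balaban1984PropagatorsII, (2.22) p.226, p.228; Balaban1985BackgroundPropagators, Thm 3.11 p.416] -/
theorem exists_coercive_deltaACubeY_parSymY_one (hb₀ : 0 < b₀) :
    ∃ m : ℝ, 0 < m ∧ ∀ C : FBondY i → Matrix (Fin N) (Fin N) ℂ, m * trIP (fun _ => (1 : ℝ)) C C ≤
      trIP (fun _ => (1 : ℝ)) C (deltaACubeY i q (parSymY i) (parBY i) (fun _ _ => 1 : CfgY (Matrix (Fin N) (Fin N) ℂ) i) C) :=
  exists_pos_coer_of_posDefTr (fun _ => one_pos) (deltaACubeY_parSymY_one_posDefTr i q hb₀)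

end Qualitative

end

end Literature.MathematicalPhysics.QuantumFieldTheory.Balaban1983to89.B9Thm311CubeLettersGCoercive
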